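import Mathlib
import HarnessLib.Audit
import Summits.PneNP.PneNP.Theorems.PstarReadSumset

/-!
# The abstract chord system of a core: pointwise sumset, M-read = M-forced, direction collapse (ROUND-24, memo §10 R2 / R5 / (★★))

FRONTIER range-avoidance ladder, rung F-N3, ROUND 24 (cell `pnp-ideate`, planner memo `r24/CORE-BOUND-NOTES.md` §2, §10 ("coordinates on
`V₀` under Assumption A", "DIRECTIONS", "SINGLE-READ BASIS", (★★)) and §9 R2/R5/R7; restricted-model proof complexity — nothing here bears
on `P` versus `NP`).

MECHANISM-FREE MODEL.  The memo's free-cube picture of a core, abstracted from the instance: a type `A` of BASE POINTS (the cube `a_B`), an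
index set `E` of CHORDS, and a `ChordSystem`

* `u e a ∈ 𝔽₂`           — the prescribed product of chord `e` at `a` (`u_e = γ_e + Q_{P_e}(a_B)`),
* `ρ e a, ρ' e a ∈ 𝔽₂²`  — the read vectors of the two privates `p_e, p'_e` in the two constraints,
* `F a ∈ 𝔽₂²`            — the state-free part of the two constraints, `t ∈ 𝔽₂²` the targets.

A STATE `s e = (p_e, p'_e)` is ADMISSIBLE at `a` on `E` when `p_e p'_e = u e a` for `e ∈ E` (`u = 1`: forced ON `(1,1)`; `u = 0`: killable,
three states), and the constraints read `val a s = F a + Σ_e (p_e ρ_e(a) + p'_e ρ'_e(a))`.  `Infeasible E`: no admissible state at any base point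
hits `t`; `ChordMinimal E e`: dropping the product condition of `e` (memo (N2)/(M0): deleting the output `e` frees its privates) makes `t`
reachable.  CROSS and GATED terms of the memo (bilinear in states / fresh variables) are NOT modelled here.

Results:
* `not_reach_of_infeasible` — **R2, pointwise sumset**: at every base point the target minus the forced contributions is not `Reach`able
  (`PstarReadSumset`) over the killable chords; so `PstarReadSumset.reach_all_or` applies pointwise;
* `read_of_chordMinimal`    — **M-read**: a chord-minimal chord is read at a base point where, its own product condition apart, `t` is hit;
* `forced_of_read`          — **M-forced** in a SINGLE-READ system (the second constraint reads no private): at a point of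
  `Z = {F₂ = t₂}` a chord read by the first constraint is forced ON, `u e a = 1`;
* `star_star`               — **(★★)**: single-read, constant read vectors, infeasible, `e` chord-minimal ⇒ `Z ⊆ {u_e = 1}`;
* `U1_or_U2_of_pairwise`, `direction_collapse` — **R5**: with constant read vectors, infeasibility makes the read vectors of any two chords
  that are killable at a common base point PARALLEL; if every pair of chords is commonly killable (memo R4: pairwise killability, from rank
  rigidity) then all read vectors lie on one line `{0, m}` (after the basis change `m ↦ (1,0)`: single-read) or exactly one chord is read.

The algebraic continuation of `star_star` is `PstarForcing.forcing_cases` (with `q := F₂ + t₂`, `Q := Q_{P_e}`, `c := γ_e + 1`).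
-/

set_option linter.dupNamespace false -- `Summit.PneNP.PneNP.…`: summit = sub-problem name (D-0017 single-conjunct layout)

open Finset
open Summit.PneNP.PneNP.Theorems.PstarReadSumset (V2 Reach)

namespace Summit.PneNP.PneNP.Theorems.PstarChordSystem

/-- Every element of `𝔽₂` is `0` or `1`. -/
private theorem zmod2_cases (t : ZMod 2) : t = 0 ∨ t = 1 := by
  revert t; decide

variable {ι A : Type*}

/-- **Chord system** (memo §10): prescribed products, read vectors of the two privates, state-free part, target. -/
structure ChordSystem (ι A : Type*) where
  /-- prescribed product `u_e(a)` of chord `e` at base point `a` -/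
  u : ι → A → ZMod 2
  /-- read vector of the private `p_e` in the two constraints -/
  ρ : ι → A → V2
  /-- read vector of the private `p'_e` -/
  ρ' : ι → A → V2
  /-- state-free part of the two constraints -/
  F : A → V2
  /-- the two targets -/
  t : V2

namespace ChordSystem

variable [DecidableEq ι] (S : ChordSystem ι A)

/-- The contribution of chord `e` in state `s e = (p_e, p'_e)`: `p_e ρ_e(a) + p'_e ρ'_e(a)`. -/
def contrib (a : A) (s : ι → ZMod 2 × ZMod 2) (e : ι) : V2 := (s e).1 • S.ρ e a + (s e).2 • S.ρ' e a

/-- The two constraint values at base point `a` in state `s`. -/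
def val (E : Finset ι) (a : A) (s : ι → ZMod 2 × ZMod 2) : V2 := S.F a + ∑ e ∈ E, S.contrib a s e

/-- Admissible states on `E` at `a`: `p_e p'_e = u_e(a)`. -/
def Adm (E : Finset ι) (a : A) (s : ι → ZMod 2 × ZMod 2) : Prop := ∀ e ∈ E, (s e).1 * (s e).2 = S.u e a

/-- INFEASIBLE: no admissible state at any base point hits the target. -/
def Infeasible (E : Finset ι) : Prop := ∀ a s, S.Adm E a s → S.val E a s ≠ S.t

/-- CHORD-MINIMAL in `e`: without the product condition of `e` the target is hit. -/
def ChordMinimal (E : Finset ι) (e : ι) : Prop := ∃ a s, S.Adm (E.erase e) a s ∧ S.val E a s = S.t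

/-- `e` is READ at `a`: one of its read vectors is non-zero. -/
def Read (e : ι) (a : A) : Prop := S.ρ e a ≠ 0 ∨ S.ρ' e a ≠ 0

/-- SINGLE-READ system: the second constraint reads no private (memo: "single-read basis"). -/
def SingleRead : Prop := ∀ e a, (S.ρ e a).2 = 0 ∧ (S.ρ' e a).2 = 0

/-! ## Bookkeeping -/

/-- Dropping a chord keeps admissibility. -/
theorem adm_erase {E : Finset ι} {a : A} {s : ι → ZMod 2 × ZMod 2} (h : S.Adm E a s) (e : ι) : S.Adm (E.erase e) a s :=
  fun e' he' => h e' (mem_of_mem_erase he')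

/-- Re-imposing the product condition of `e` by updating its state. -/
theorem adm_update {E : Finset ι} {a : A} {s : ι → ZMod 2 × ZMod 2} {e : ι} (h : S.Adm (E.erase e) a s)
    {x : ZMod 2 × ZMod 2} (hx : x.1 * x.2 = S.u e a) : S.Adm E a (Function.update s e x) := by
  intro e' he'
  by_cases hee : e' = e
  · subst hee; rw [Function.update_self]; exact hx
  · rw [Function.update_of_ne hee]; exact h e' (mem_erase.2 ⟨hee, he'⟩)

/-- The contribution of `e` after updating its state to `x`. -/
theorem contrib_update_self (a : A) (s : ι → ZMod 2 × ZMod 2) (e : ι) (x : ZMod 2 × ZMod 2) :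
    S.contrib a (Function.update s e x) e = x.1 • S.ρ e a + x.2 • S.ρ' e a := by
  unfold contrib; rw [Function.update_self]

/-- Splitting off the contribution of one chord. -/
theorem val_eq {E : Finset ι} {e : ι} (he : e ∈ E) (a : A) (s : ι → ZMod 2 × ZMod 2) :
    S.val E a s = S.contrib a s e + S.val (E.erase e) a s := by
  unfold val
  rw [← add_sum_erase E _ he, add_left_comm]

/-- The other chords do not see the state of `e`. -/
theorem val_erase_update (E : Finset ι) (a : A) (s : ι → ZMod 2 × ZMod 2) (e : ι) (x : ZMod 2 × ZMod 2) :
    S.val (E.erase e) a (Function.update s e x) = S.val (E.erase e) a s := by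
  unfold val
  have h : ∀ e' ∈ E.erase e, S.contrib a (Function.update s e x) e' = S.contrib a s e' := fun e' he' => by
    unfold contrib; rw [Function.update_of_ne (ne_of_mem_erase he')]
  rw [sum_congr rfl h]

omit [DecidableEq ι] in
/-- Some state satisfies the product condition of `e` at `a` (namely `(u_e(a), 1)`). -/
theorem exists_adm_state (e : ι) (a : A) : ∃ x : ZMod 2 × ZMod 2, x.1 * x.2 = S.u e a :=
  ⟨(S.u e a, 1), by rw [mul_one]⟩

/-! ## R2: the pointwise sumset condition -/

omit [DecidableEq ι] in
/-- **Infeasibility pointwise (memo R2).**  At every base point the target, corrected by the state-free part and the forced chords' contributions,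
is NOT reachable over the killable chords (`PstarReadSumset.Reach`); hence `PstarReadSumset.reach_all_or` yields (U1) or (U2) at every point. -/
theorem not_reach_of_infeasible {E : Finset ι} (hI : S.Infeasible E) (a : A) :
    ¬ Reach (E.filter fun e => S.u e a = 0) (fun e => S.ρ e a) (fun e => S.ρ' e a)
      (S.t + S.F a + ∑ e ∈ E.filter (fun e => ¬ S.u e a = 0), (S.ρ e a + S.ρ' e a)) := by
  rintro ⟨g, hg, hsum⟩
  -- realise the choice `g` by admissible states
  let s : ι → ZMod 2 × ZMod 2 := fun e =>
    if S.u e a = 0 then (if g e = S.ρ e a then (1, 0) else if g e = S.ρ' e a then (0, 1) else (0, 0)) else (1, 1)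
  have hadm : S.Adm E a s := by
    intro e _
    by_cases hu : S.u e a = 0
    · simp only [s, hu, if_true]
      split_ifs <;> simp
    · simp only [s, hu, if_false, mul_one]
      rcases zmod2_cases (S.u e a) with h | h
      · exact absurd h hu
      · exact h.symm
  have hkill : ∀ e ∈ E.filter (fun e => S.u e a = 0), S.contrib a s e = g e := by
    intro e he
    obtain ⟨-, hu⟩ := mem_filter.1 he
    unfold contrib
    simp only [s, hu, if_true]
    by_cases h1 : g e = S.ρ e a
    · rw [if_pos h1, h1, one_smul, zero_smul, add_zero]
    · by_cases h2 : g e = S.ρ' e a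
      · rw [if_neg h1, if_pos h2, h2, one_smul, zero_smul, zero_add]
      · rw [if_neg h1, if_neg h2, zero_smul, zero_smul, add_zero]
        rcases hg e he with h | h | h
        · exact h.symm
        · exact absurd h h1
        · exact absurd h h2
  have hforce : ∀ e ∈ E.filter (fun e => ¬ S.u e a = 0), S.contrib a s e = S.ρ e a + S.ρ' e a := by
    intro e he
    obtain ⟨-, hu⟩ := mem_filter.1 he
    unfold contrib
    simp only [s, hu, if_false, one_smul]
  refine hI a s hadm ?_
  unfold val
  rw [← sum_filter_add_sum_filter_not E (fun e => S.u e a = 0), sum_congr rfl hkill, sum_congr rfl hforce, hsum]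
  generalize S.F a = f
  generalize ∑ e ∈ E.filter (fun e => ¬ S.u e a = 0), (S.ρ e a + S.ρ' e a) = r
  have : ∀ f r tt : V2, f + (tt + f + r + r) = tt := by decide
  exact this f r S.t

/-! ## M-read and M-forced -/

/-- **M-read.**  If the system is infeasible but chord-minimal in `e ∈ E`, then at the witnessing base point `e` is read. -/
theorem read_of_chordMinimal {E : Finset ι} (hI : S.Infeasible E) {e : ι} (he : e ∈ E) (hM : S.ChordMinimal E e) :
    ∃ a s, S.Adm (E.erase e) a s ∧ S.val E a s = S.t ∧ S.Read e a := by
  obtain ⟨a, s, hadm, hval⟩ := hM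
  refine ⟨a, s, hadm, hval, ?_⟩
  by_contra hno
  unfold Read at hno
  push Not at hno
  obtain ⟨h1, h2⟩ := hno
  -- re-impose the product condition of `e`: its contribution is `0` in every state
  obtain ⟨x, hx⟩ := S.exists_adm_state e a
  refine hI a (Function.update s e x) (S.adm_update hadm hx) ?_
  rw [S.val_eq he, S.val_erase_update, S.contrib_update_self, h1, h2, smul_zero, smul_zero, add_zero, zero_add]
  rw [S.val_eq he] at hval
  unfold contrib at hval
  rw [h1, h2, smul_zero, smul_zero, add_zero, zero_add] at hval
  exact hval

omit [DecidableEq ι] in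
/-- In a single-read system the second constraint value is state-free. -/
theorem val_snd_of_singleRead (hS : S.SingleRead) (E : Finset ι) (a : A) (s : ι → ZMod 2 × ZMod 2) : (S.val E a s).2 = (S.F a).2 := by
  unfold val
  rw [Prod.snd_add, Prod.snd_sum]
  have h0 : ∑ e ∈ E, (S.contrib a s e).2 = 0 :=
    sum_eq_zero fun e _ => by
      unfold contrib
      simp only [Prod.snd_add, Prod.smul_snd, (hS e a).1, (hS e a).2, smul_zero, add_zero]
  rw [h0, add_zero]

/-- **M-forced (single-read).**  In an infeasible single-read system, at a base point of `Z = {F₂ = t₂}` every chord of `E` that is read there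
is forced ON: `u e a = 1`. -/
theorem forced_of_read (hS : S.SingleRead) {E : Finset ι} (hI : S.Infeasible E) {e : ι} (he : e ∈ E) {a : A}
    (hZ : (S.F a).2 = S.t.2) (hR : S.Read e a) : S.u e a = 1 := by
  rcases zmod2_cases (S.u e a) with hu | hu
  swap
  · exact hu
  exfalso
  -- the canonical admissible state: forced chords ON, killable chords OFF
  let s₀ : ι → ZMod 2 × ZMod 2 := fun e' => (S.u e' a, 1)
  have hadm₀ : S.Adm (E.erase e) a s₀ := fun e' _ => by simp [s₀]
  -- the first-coordinate defect without `e`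
  set c := S.val (E.erase e) a s₀ with hc
  have hc2 : c.2 = S.t.2 := by rw [hc, S.val_snd_of_singleRead hS]; exact hZ
  -- a killed state of `e` realising the missing first coordinate
  have hread1 : (S.ρ e a).1 = 1 ∨ (S.ρ' e a).1 = 1 := by
    rcases hR with h | h
    · left
      rcases zmod2_cases (S.ρ e a).1 with h1 | h1
      · exact absurd (Prod.ext h1 (hS e a).1) h
      · exact h1
    · right
      rcases zmod2_cases (S.ρ' e a).1 with h1 | h1
      · exact absurd (Prod.ext h1 (hS e a).2) h
      · exact h1
  obtain ⟨x, hx0, hx⟩ : ∃ x : ZMod 2 × ZMod 2, x.1 * x.2 = 0 ∧ (x.1 • S.ρ e a + x.2 • S.ρ' e a) + c = S.t := by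
    rcases zmod2_cases (c.1 + S.t.1) with h0 | h0
    · refine ⟨(0, 0), by simp, ?_⟩
      rw [zero_smul, zero_smul, add_zero, zero_add]
      refine Prod.ext ?_ hc2
      have e2 : ∀ p q : ZMod 2, p + q = 0 → p = q := by decide
      exact e2 _ _ h0
    · have e2 : ∀ p q : ZMod 2, p + q = 1 → 1 + p = q := by decide
      rcases hread1 with h1 | h1
      · refine ⟨(1, 0), by simp, Prod.ext ?_ ?_⟩
        · rw [one_smul, zero_smul, add_zero, Prod.fst_add, h1]; exact e2 _ _ h0
        · rw [one_smul, zero_smul, add_zero, Prod.snd_add, (hS e a).1, zero_add]; exact hc2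
      · refine ⟨(0, 1), by simp, Prod.ext ?_ ?_⟩
        · rw [zero_smul, one_smul, zero_add, Prod.fst_add, h1]; exact e2 _ _ h0
        · rw [zero_smul, one_smul, zero_add, Prod.snd_add, (hS e a).2, zero_add]; exact hc2
  refine hI a (Function.update s₀ e x) (S.adm_update hadm₀ (by rw [hx0, hu])) ?_
  rw [S.val_eq he, S.val_erase_update, S.contrib_update_self, ← hc]
  exact hx

/-- **(★★) (memo §10).**  Single-read system with CONSTANT read vectors, infeasible and chord-minimal in `e ∈ E`: the chord `e` is forced ON on
all of `Z = {F₂ = t₂}`. -/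
theorem star_star (hS : S.SingleRead) (hconst : ∀ e a a', S.ρ e a = S.ρ e a' ∧ S.ρ' e a = S.ρ' e a') {E : Finset ι}
    (hI : S.Infeasible E) {e : ι} (he : e ∈ E) (hM : S.ChordMinimal E e) : ∀ a, (S.F a).2 = S.t.2 → S.u e a = 1 := by
  intro a hZ
  obtain ⟨a₀, -, -, -, hR⟩ := S.read_of_chordMinimal hI he hM
  have hR' : S.Read e a := by
    unfold Read at hR ⊢
    rw [(hconst e a a₀).1, (hconst e a a₀).2]
    exact hR
  exact S.forced_of_read hS hI he hZ hR'

/-! ## R5: direction collapse -/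

/-- Combinatorics of read vectors in `𝔽₂²`: if non-zero read vectors at DIFFERENT indices always coincide, then (U1) all read vectors lie in
`{0, m}` for one `m`, or (U2) one index carries two independent read vectors and all others read nothing. -/
theorem U1_or_U2_of_pairwise {E : Finset ι} {ρ ρ' : ι → V2}
    (hP : ∀ i ∈ E, ∀ j ∈ E, i ≠ j → ∀ x y : V2, (x = ρ i ∨ x = ρ' i) → (y = ρ j ∨ y = ρ' j) → x ≠ 0 → y ≠ 0 → x = y) :
    (∃ m : V2, ∀ i ∈ E, (ρ i = 0 ∨ ρ i = m) ∧ (ρ' i = 0 ∨ ρ' i = m)) ∨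
    (∃ i₀ ∈ E, ρ i₀ ≠ 0 ∧ ρ' i₀ ≠ 0 ∧ ρ i₀ ≠ ρ' i₀ ∧ ∀ i ∈ E, i ≠ i₀ → ρ i = 0 ∧ ρ' i = 0) := by
  classical
  by_cases hind : ∃ i₀ ∈ E, ρ i₀ ≠ 0 ∧ ρ' i₀ ≠ 0 ∧ ρ i₀ ≠ ρ' i₀
  · right
    obtain ⟨i₀, hi₀, h1, h2, h3⟩ := hind
    refine ⟨i₀, hi₀, h1, h2, h3, fun i hi hne => ⟨?_, ?_⟩⟩
    · by_contra h
      exact h3 ((hP i hi i₀ hi₀ hne (ρ i) (ρ i₀) (Or.inl rfl) (Or.inl rfl) h h1).symm.trans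
        (hP i hi i₀ hi₀ hne (ρ i) (ρ' i₀) (Or.inl rfl) (Or.inr rfl) h h2))
    · by_contra h
      exact h3 ((hP i hi i₀ hi₀ hne (ρ' i) (ρ i₀) (Or.inr rfl) (Or.inl rfl) h h1).symm.trans
        (hP i hi i₀ hi₀ hne (ρ' i) (ρ' i₀) (Or.inr rfl) (Or.inr rfl) h h2))
  · left
    push Not at hind
    by_cases hex : ∃ i ∈ E, ∃ x : V2, (x = ρ i ∨ x = ρ' i) ∧ x ≠ 0
    · obtain ⟨i₁, hi₁, m, hm, hm0⟩ := hex
      refine ⟨m, fun j hj => ?_⟩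
      -- every non-zero read vector equals `m`
      have key : ∀ y : V2, (y = ρ j ∨ y = ρ' j) → y = 0 ∨ y = m := by
        intro y hy
        by_cases hy0 : y = 0
        · exact Or.inl hy0
        right
        by_cases hji : j = i₁
        · -- no independent pair at `i₁ = j`
          rw [← hji] at hm
          have hi := hind j hj
          rcases hm with rfl | rfl <;> rcases hy with rfl | rfl
          · rfl
          · exact (hi hm0 hy0).symm
          · exact hi hy0 hm0
          · rfl
        · exact (hP i₁ hi₁ j hj (Ne.symm hji) m y hm hy hm0 hy0).symm
      exact ⟨key (ρ j) (Or.inl rfl), key (ρ' j) (Or.inr rfl)⟩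
    · push Not at hex
      exact ⟨0, fun j hj => ⟨Or.inl (hex j hj (ρ j) (Or.inl rfl)), Or.inl (hex j hj (ρ' j) (Or.inr rfl))⟩⟩

/-- **Non-parallel reads are never commonly killable.**  With constant read vectors `r, r'`: if chords `e ≠ e'` of `E` carry non-zero read
vectors `x ≠ y`, then at no base point are both killable. -/
theorem not_killable_pair {E : Finset ι} (hI : S.Infeasible E) {r r' : ι → V2}
    (hr : ∀ e a, S.ρ e a = r e) (hr' : ∀ e a, S.ρ' e a = r' e) {e e' : ι} (he : e ∈ E) (he' : e' ∈ E) (hne : e ≠ e')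
    {x y : V2} (hx : x = r e ∨ x = r' e) (hy : y = r e' ∨ y = r' e') (hx0 : x ≠ 0) (hy0 : y ≠ 0) (hxy : x ≠ y) (a : A) :
    ¬ (S.u e a = 0 ∧ S.u e' a = 0) := by
  rintro ⟨hu, hu'⟩
  apply S.not_reach_of_infeasible hI a
  have heK : e ∈ E.filter (fun e => S.u e a = 0) := mem_filter.2 ⟨he, hu⟩
  have heK' : e' ∈ E.filter (fun e => S.u e a = 0) := mem_filter.2 ⟨he', hu'⟩
  have hx' : x = (fun e => S.ρ e a) e ∨ x = (fun e => S.ρ' e a) e := by simp only [hr, hr']; exact hx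
  have hy' : y = (fun e => S.ρ e a) e' ∨ y = (fun e => S.ρ' e a) e' := by simp only [hr, hr']; exact hy
  generalize S.t + S.F a + ∑ e ∈ E.filter (fun e => ¬ S.u e a = 0), (S.ρ e a + S.ρ' e a) = v
  rcases PstarReadSumset.span_two hx0 hy0 hxy v with h | h | h | h <;> rw [h]
  · simpa using PstarReadSumset.reach_pair _ _ _ heK heK' hne (x := 0) (y := 0) (Or.inl rfl) (Or.inl rfl)
  · simpa using PstarReadSumset.reach_pair _ _ _ heK heK' hne (x := x) (y := 0) (Or.inr hx') (Or.inl rfl)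
  · simpa using PstarReadSumset.reach_pair _ _ _ heK heK' hne (x := 0) (y := y) (Or.inl rfl) (Or.inr hy')
  · exact PstarReadSumset.reach_pair _ _ _ heK heK' hne (Or.inr hx') (Or.inr hy')

/-- **R5 — direction collapse.**  Constant read vectors, infeasible, and every two chords killable at a common base point (memo R4, pairwise
killability): then all read vectors lie on one line `{0, m}` (U1: after the basis change `m ↦ (1,0)` the system is single-read) or exactly one
chord is read, with two independent read vectors (U2: the one-chord corner, memo O3). -/
theorem direction_collapse {E : Finset ι} (hI : S.Infeasible E) {r r' : ι → V2} (hr : ∀ e a, S.ρ e a = r e)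
    (hr' : ∀ e a, S.ρ' e a = r' e) (hK : ∀ e ∈ E, ∀ e' ∈ E, e ≠ e' → ∃ a, S.u e a = 0 ∧ S.u e' a = 0) :
    (∃ m : V2, ∀ e ∈ E, (r e = 0 ∨ r e = m) ∧ (r' e = 0 ∨ r' e = m)) ∨
    (∃ e₀ ∈ E, r e₀ ≠ 0 ∧ r' e₀ ≠ 0 ∧ r e₀ ≠ r' e₀ ∧ ∀ e ∈ E, e ≠ e₀ → r e = 0 ∧ r' e = 0) := by
  refine U1_or_U2_of_pairwise fun i hi j hj hij x y hx hy hx0 hy0 => ?_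
  by_contra hxy
  obtain ⟨a, ha⟩ := hK i hi j hj hij
  exact S.not_killable_pair hI hr hr' hi hj hij hx hy hx0 hy0 hxy a ha

/-! ## R6: no free lunch -/

/-- **R6 — no free lunch (memo §10).**  If a direction is available at EVERY base point with the constant vector `(1,0)` — modelled as a chord
`e₀ ∈ E` that is always killable (`u_{e₀} ≡ 0`) and read as `ρ_{e₀} ≡ (1,0)`, `ρ'_{e₀} ≡ 0` (a free bit of the first constraint: a root bit with
`ε ≠ 0`, a fresh linear variable, a both-fresh monomial) — then infeasibility is carried by the SECOND constraint alone: no admissible state at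
any base point satisfies it.  (In the instance this makes `J` minimal infeasible for one parity constraint, which the `h = 1` theorem
`PstarGSat.pstarGapOne` forbids: no core.) -/
theorem no_free_lunch {E : Finset ι} (hI : S.Infeasible E) {e₀ : ι} (he₀ : e₀ ∈ E) (hu₀ : ∀ a, S.u e₀ a = 0)
    (hρ₀ : ∀ a, S.ρ e₀ a = (1, 0)) (hρ₀' : ∀ a, S.ρ' e₀ a = 0) :
    ∀ a s, S.Adm E a s → (S.val E a s).2 ≠ S.t.2 := by
  intro a s hadm h2
  -- the value without the free bit
  set c := S.val (E.erase e₀) a s with hc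
  have hsplit := S.val_eq he₀ a s
  have hc2 : c.2 = S.t.2 := by
    have := congrArg Prod.snd hsplit
    rw [Prod.snd_add] at this
    unfold contrib at this
    rw [Prod.snd_add, Prod.smul_snd, Prod.smul_snd, hρ₀, hρ₀', Prod.snd_zero, smul_zero, smul_zero, zero_add, zero_add] at this
    rw [← this]; exact h2
  -- flip the free bit to repair the first coordinate
  obtain ⟨x, hx0, hx⟩ : ∃ x : ZMod 2 × ZMod 2, x.1 * x.2 = 0 ∧ (x.1 • S.ρ e₀ a + x.2 • S.ρ' e₀ a) + c = S.t := by
    rcases zmod2_cases (c.1 + S.t.1) with h0 | h0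
    · refine ⟨(0, 0), by simp, ?_⟩
      rw [zero_smul, zero_smul, add_zero, zero_add]
      have e2 : ∀ p q : ZMod 2, p + q = 0 → p = q := by decide
      exact Prod.ext (e2 _ _ h0) hc2
    · refine ⟨(1, 0), by simp, Prod.ext ?_ ?_⟩
      · rw [one_smul, zero_smul, add_zero, Prod.fst_add, hρ₀]
        have e2 : ∀ p q : ZMod 2, p + q = 1 → 1 + p = q := by decide
        exact e2 _ _ h0
      · rw [one_smul, zero_smul, add_zero, Prod.snd_add, hρ₀, zero_add]; exact hc2
  refine hI a (Function.update s e₀ x) (S.adm_update (S.adm_erase hadm e₀) (by rw [hx0, hu₀])) ?_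
  rw [S.val_eq he₀, S.val_erase_update, S.contrib_update_self, ← hc]
  exact hx

end ChordSystem

end Summit.PneNP.PneNP.Theorems.PstarChordSystem
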